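import Summits.BirchSwinnertonDyer.Rank1Residual.Additive.RamifiedSevenIntegralComparisonOfInputsR
import Summits.BirchSwinnertonDyer.BirchSwinnertonDyer.Theorems.RamifiedSevenEllipticUnitsStrictControlLocalAtSeven

/-!
# K2C-9R port 1/4 (§A): 7-adic norm kernels — `x² + 7y²` anisotropic over `ℤ₇`, the normal form `N = w·7^{v(N)}`, the descent `7^j ∣ N(α) ⟹ π^j ∣ φα₀ − φα₁·π`, `−7 ∉ (ℚ₇)²` and the injective reading `ℚ₇ ⊕ ℚ₇√−7 → ℂ`

PORT (cell bsd-cm, seat bsd-cm-k-ty1 g32; row K2C-9R of crux `EllipticUnitValueSevenOfGZK`, route K7r) of the DRAFT-OF-RECORD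
`Cruxes/EllipticUnitValueSevenOfGZK/K2C9RKatoExpDatumPadic_g80.lean` (bsd-idea-20 g80, tree f21b9ca41d3d0893, 1342 l.; pen GO
D1086 (II) (c1)–(c4), letter of record D1087 (II), port rules (p1)–(p4): namespace `…Additive.GenusSeven`, four files split at the
`## §` headers (§A | §C+§D | §B+§E | §F+§G), the landed `KatoExpDatum` / K2C-9 files / `RamifiedSevenPeriodPositionKernel.lean`
untouched, 0 facts, cite tags carried).  Declarations = the draft's, VERBATIM (statements and proofs), only re-homed.
WHY (pen D1085 (ρ1)): Kato's constant of (15.16.1) for the `Λˣ`-normalised ★-class lives in `(O_K ⊗ ℤ₇) ∖ {0}`, not in `O_K`;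
the padic datum re-types the pair `(α₀, α₁)` 7-adically and block (R), (KI)-R, (PK)-R go through with the same binders and the
SAME conclusions, the period-position exponent becoming `jα = v₇(α₀² + 7α₁²)`.

WHAT THIS FILE HOLDS (the draft's docstring for its sections):
§A 7-ADIC KERNELS (Mathlib-only; re-proved from the seat's g79 workfile `EZConstantPadic_g79.lean`, not importable):
  `normSeven_eq_zero_iff` (`x² + 7y²` anisotropic over `ℤ₇`, descent on `v₇`), `normSeven_ne_zero`,
  `eq_unitCoeff_mul_pow_valuation`/`pow_valuation_dvd` (normal form `x = w·7^{v(x)}` through Mathlib `PadicInt.unitCoeff`,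
  `PadicInt.valuation : ℤ_[p] → ℕ`; `2 ∈ ℤ₇ˣ` is the tree's `GenusDatum.isUnit_two`), the DESCENT `pow_dvd_map_sub_map_mul` (`7^j ∣ α₀² + 7α₁² ⟹
  π^j ∣ φ α₀ − φ α₁·π` for any ring map `φ : ℤ₇ → R`, `7 = v·π²`; the 7-adic currency of the tree's
  `PeriodPosition.pow_dvd_intCast_sub_intCast_mul`), the D916 shape `pow_dvd_const_mul_of_le` and `pow_dvd_constZ_mul_of_le`,
  and the READING (`−7 ∉ (ℚ₇)²` is the tree's `RamifiedSevenEllipticUnits.not_sq_eq_neg_seven_padic`): `padicReading_eq_zero_iff`/`padicReading_ne_zero`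
  (`ι a + ι b·s = 0 ↔ a = b = 0` for `ι : ℚ₇ →+* ℂ`, `s² = −7`) — the (H-γ)-compatible replacement of
  `PinnedKatoGenusFrame.intCast_add_mul_sqrt_ne_zero`.

HONEST LABEL: infrastructure (kernel lemmas / a hypothesis structure / definitions / conditional implications); it closes no
item, registers no stub, proves no summit statement; every ★/★′/★″ is CONDITIONAL on its displayed binders; nothing is asserted
to exist; stmt-BirchSwinnertonDyer-19945 is OPEN; `X12.CMRamifiedSeven` is NOT proved; BSD is claimed for no curve.  No `sorry`,
no `instance`, no `notation`/`macro`, no named fact, no attribute removed.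

References: [Kato2004Asterisque] K. Kato, p-adic Hodge theory and values of zeta functions of modular forms, Astérisque 295
(2004): Thm. 12.4 (2) / 12.5 (1) (p. 221), 13.5 (p. 227), §13.9 (p. 230), Prop. 15.9 (15.9.1) (pp. 258–259), (15.12.2)
(p. 263), 15.14 (p. 264), §15.16 (15.16.1) (p. 265); [BlochKato1990] S. Bloch, K. Kato, L-functions and Tamagawa numbers of
motives, Def. 3.10, Ex. 3.10.1–3.11 (pp. 359–361); [Washington1997] L. Washington, Introduction to Cyclotomic Fields, §7.1
(Prop. 7.2), §13.2; [NeukirchSchmidtWingberg2008] J. Neukirch, A. Schmidt, K. Wingberg, Cohomology of Number Fields, XI §1–§2;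
[Serre1973] J.-P. Serre, A Course in Arithmetic, Ch. II §2 (squares in `ℚ_p`: `−7 ∉ (ℚ₇)²`).
-/

noncomputable section

open scoped NumberField TensorProduct
open Field IsDedekindDomain NumberField Polynomial
open Literature.NumberTheory.GaloisRepresentations
open Literature.NumberTheory.EllipticCurves
open Literature.NumberTheory.EllipticCurves.Rank1Residual
open Literature.NumberTheory.EllipticCurves.IwasawaAlgebra
open Literature.NumberTheory.EllipticCurves.Kato2004
open Literature.NumberTheory.ComplexMultiplication.EllipticUnits
open Summit.BirchSwinnertonDyer.Rank1Residual
open Summit.BirchSwinnertonDyer.Rank1Residual.Additive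
open Summit.BirchSwinnertonDyer.BirchSwinnertonDyer.Theorems

namespace Summit.BirchSwinnertonDyer.Rank1Residual.Additive.GenusSeven

/-! ## §A  7-adic kernels: anisotropy of `x² + 7y²` over `ℤ₇`, the normal form `N = w·7^{v(N)}`, the descent
`7^j ∣ α₀² + 7α₁² ⟹ π^j ∣ φ α₀ − φ α₁·π`, the D916 divisibility shape, and the injective reading `ℚ₇ ⊕ ℚ₇√−7 → ℂ`
(re-proved from the seat's workfile `EZConstantPadic_g79.lean` (HOME g79/, sha16 85212f38278320e8) — workfiles are not importable) -/

section Padic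

variable [Fact (Nat.Prime 7)]

/-- `7` is prime in `ℤ₇`. [folklore] -/
theorem prime_seven_padicInt : Prime (7 : ℤ_[7]) := by
  simpa using (PadicInt.prime_p (p := 7))

/-- `7 ≠ 0` in `ℤ₇`. [folklore] -/
theorem seven_ne_zero_padicInt : (7 : ℤ_[7]) ≠ 0 := prime_seven_padicInt.ne_zero

/-- `v(7·x) = 1 + v(x)` for `x ≠ 0`. [folklore] -/
theorem valuation_seven_mul {x : ℤ_[7]} (hx : x ≠ 0) : ((7 : ℤ_[7]) * x).valuation = 1 + x.valuation := by
  rw [PadicInt.valuation_mul seven_ne_zero_padicInt hx]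
  simpa using (PadicInt.valuation_p (p := 7))

/-- One descent step: a solution of `a² + 7b² = 0` in `ℤ₇` is `7`·(a solution). [folklore] -/
theorem normSeven_descent {a b : ℤ_[7]} (h : a ^ 2 + 7 * b ^ 2 = 0) :
    ∃ a' b' : ℤ_[7], a = 7 * a' ∧ b = 7 * b' ∧ a' ^ 2 + 7 * b' ^ 2 = 0 := by
  have h7a2 : (7 : ℤ_[7]) ∣ a ^ 2 := ⟨-b ^ 2, by linear_combination h⟩
  obtain ⟨a', rfl⟩ := prime_seven_padicInt.dvd_of_dvd_pow h7a2
  have h' : (7 : ℤ_[7]) * (7 * a' ^ 2 + b ^ 2) = 7 * 0 := by linear_combination h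
  have h'' : 7 * a' ^ 2 + b ^ 2 = 0 := mul_left_cancel₀ seven_ne_zero_padicInt h'
  have h7b2 : (7 : ℤ_[7]) ∣ b ^ 2 := ⟨-a' ^ 2, by linear_combination h''⟩
  obtain ⟨b', rfl⟩ := prime_seven_padicInt.dvd_of_dvd_pow h7b2
  refine ⟨a', b', rfl, rfl, ?_⟩
  have h3 : (7 : ℤ_[7]) * (a' ^ 2 + 7 * b' ^ 2) = 7 * 0 := by linear_combination h''
  exact mul_left_cancel₀ seven_ne_zero_padicInt h3

/-- **`x² + 7y²` is anisotropic over `ℤ₇`**: `a² + 7b² = 0 ↔ a = 0 ∧ b = 0` (descent on `v(a)`). [folklore] -/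
theorem normSeven_eq_zero_iff (a b : ℤ_[7]) : a ^ 2 + 7 * b ^ 2 = 0 ↔ a = 0 ∧ b = 0 := by
  constructor
  · intro h
    suffices ha : a = 0 by
      subst ha
      have : (7 : ℤ_[7]) * b ^ 2 = 0 := by simpa using h
      rcases mul_eq_zero.mp this with h7 | hb
      · exact absurd h7 seven_ne_zero_padicInt
      · exact ⟨rfl, pow_eq_zero_iff (n := 2) (by norm_num) |>.mp hb⟩
    by_contra ha
    have key : ∀ n : ℕ, ∀ a b : ℤ_[7], a ≠ 0 → a.valuation = n → a ^ 2 + 7 * b ^ 2 = 0 → False := by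
      intro n
      induction n using Nat.strong_induction_on with
      | _ n ih =>
        intro a b ha hn h
        obtain ⟨a', b', rfl, rfl, h'⟩ := normSeven_descent h
        have ha' : a' ≠ 0 := by
          rintro rfl
          exact ha (by simp)
        have hv : (7 * a').valuation = 1 + a'.valuation := valuation_seven_mul ha'
        exact ih a'.valuation (by omega) a' b' ha' rfl h'
    exact key a.valuation a b ha rfl h
  · rintro ⟨rfl, rfl⟩
    simp

/-- `(α₀, α₁) ≠ 0 ⟹ α₀² + 7α₁² ≠ 0` in `ℤ₇`. [cite: Kato2004Asterisque, (15.16.1) (p. 265)] -/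
theorem normSeven_ne_zero {α₀ α₁ : ℤ_[7]} (h : α₀ ≠ 0 ∨ α₁ ≠ 0) : α₀ ^ 2 + 7 * α₁ ^ 2 ≠ 0 := by
  intro h0
  obtain ⟨h1, h2⟩ := (normSeven_eq_zero_iff α₀ α₁).mp h0
  rcases h with h | h
  · exact h h1
  · exact h h2

/-- **Normal form**: a non-zero `x ∈ ℤ₇` is `w·7^{v(x)}` with `w = PadicInt.unitCoeff` a unit; `PadicInt.valuation : ℤ_[p] → ℕ`.
[folklore] -/
theorem eq_unitCoeff_mul_pow_valuation {x : ℤ_[7]} (hx : x ≠ 0) :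
    x = (PadicInt.unitCoeff hx : ℤ_[7]) * 7 ^ x.valuation := by
  simpa using PadicInt.unitCoeff_spec hx

/-- `7^{v(x)} ∣ x`. [folklore] -/
theorem pow_valuation_dvd {x : ℤ_[7]} (hx : x ≠ 0) : (7 : ℤ_[7]) ^ x.valuation ∣ x :=
  ⟨PadicInt.unitCoeff hx, by rw [mul_comm]; exact eq_unitCoeff_mul_pow_valuation hx⟩

/-- The integers prime to `7` are units of `ℤ₇`. [folklore] -/
theorem isUnit_intCast_padicInt_of_not_dvd {k : ℤ} (hk : ¬ (7 : ℤ) ∣ k) : IsUnit ((k : ℤ_[7])) := by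
  rw [PadicInt.isUnit_iff]
  have hle := PadicInt.norm_le_one ((k : ℤ_[7]))
  have hlt : ¬ ‖((k : ℤ_[7]))‖ < 1 := by
    rw [PadicInt.norm_int_lt_one_iff_dvd]; exact_mod_cast hk
  exact le_antisymm hle (not_lt.mp hlt)

section Kernel

variable {R : Type*} [CommRing R]

/-- **`π^j ∣ φ α₀ − φ α₁·π` whenever `7^j ∣ α₀² + 7α₁²` (`α₀, α₁ ∈ ℤ₇`)**, for any ring map `φ : ℤ₇ → R` into a commutative
ring with `7 = v·π²` — the 7-adic currency of the tree's `PeriodPosition.pow_dvd_intCast_sub_intCast_mul` (same induction on `j`).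
[cite: Kato2004Asterisque, (15.16.1) (p. 265)] -/
theorem pow_dvd_map_sub_map_mul (φ : ℤ_[7] →+* R) (π v : R) (h7 : (7 : R) = v * π ^ 2) :
    ∀ (j : ℕ) (α₀ α₁ : ℤ_[7]), (7 : ℤ_[7]) ^ j ∣ α₀ ^ 2 + 7 * α₁ ^ 2 → π ^ j ∣ (φ α₀ - φ α₁ * π) := by
  intro j
  induction j using Nat.strong_induction_on with
  | _ j ih =>
    intro α₀ α₁ hdvd
    match j, ih, hdvd with
    | 0, _, _ => exact ⟨φ α₀ - φ α₁ * π, by ring⟩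
    | 1, _, hdvd =>
      have h7N : (7 : ℤ_[7]) ∣ α₀ ^ 2 + 7 * α₁ ^ 2 := by simpa using hdvd
      have h7a : (7 : ℤ_[7]) ∣ α₀ ^ 2 := (dvd_add_left (dvd_mul_right (7 : ℤ_[7]) (α₁ ^ 2))).mp h7N
      obtain ⟨a, rfl⟩ := prime_seven_padicInt.dvd_of_dvd_pow h7a
      refine ⟨v * π * φ a - φ α₁, ?_⟩
      rw [map_mul, map_ofNat, h7]
      ring
    | j + 2, ih, hdvd =>
      have h7N : (7 : ℤ_[7]) ∣ α₀ ^ 2 + 7 * α₁ ^ 2 :=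
        (dvd_pow_self (7 : ℤ_[7]) (by omega : j + 2 ≠ 0)).trans hdvd
      have h7a : (7 : ℤ_[7]) ∣ α₀ ^ 2 := (dvd_add_left (dvd_mul_right (7 : ℤ_[7]) (α₁ ^ 2))).mp h7N
      obtain ⟨a, rfl⟩ := prime_seven_padicInt.dvd_of_dvd_pow h7a
      have h49 : (7 : ℤ_[7]) ^ 2 ∣ (7 * a) ^ 2 + 7 * α₁ ^ 2 :=
        (pow_dvd_pow (7 : ℤ_[7]) (by omega : 2 ≤ j + 2)).trans hdvd
      have h49' : (7 : ℤ_[7]) * 7 ∣ 7 * α₁ ^ 2 := by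
        have h1 : (7 : ℤ_[7]) ^ 2 ∣ (7 * a) ^ 2 := ⟨a ^ 2, by ring⟩
        have h2 := (dvd_add_right h1).mp h49
        simpa [pow_two] using h2
      have h7b2 : (7 : ℤ_[7]) ∣ α₁ ^ 2 := (mul_dvd_mul_iff_left seven_ne_zero_padicInt).mp h49'
      obtain ⟨b, rfl⟩ := prime_seven_padicInt.dvd_of_dvd_pow h7b2
      have hj : (7 : ℤ_[7]) ^ j ∣ a ^ 2 + 7 * b ^ 2 := by
        have h1 : (7 : ℤ_[7]) ^ (j + 2) = 7 ^ 2 * 7 ^ j := by ring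
        have h2 : (7 * a) ^ 2 + 7 * (7 * b) ^ 2 = (7 : ℤ_[7]) ^ 2 * (a ^ 2 + 7 * b ^ 2) := by ring
        rw [h1, h2] at hdvd
        exact (mul_dvd_mul_iff_left (pow_ne_zero 2 seven_ne_zero_padicInt)).mp hdvd
      obtain ⟨c, hc⟩ := ih j (by omega) a b hj
      refine ⟨v * c, ?_⟩
      rw [map_mul, map_mul, map_ofNat]
      have h3 : (7 : R) * φ a - 7 * φ b * π = 7 * (φ a - φ b * π) := by ring
      rw [h3, hc, h7]
      ring

omit [Fact (Nat.Prime 7)] in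
/-- **The D916 divisibility SHAPE** (general `t`-gauge): if `π^j ∣ x` then
`m₀ + 2j ≤ j + (2e + 2k + a) + m′ ⟹ π^(m₀ + 2j) ∣ ((x·7^e)·(w·(7^k·(u·π^a))))·(w′·π^{m′})`, in any commutative ring with
`7 = v·π²`; no unit hypothesis on `v, w, u, w′`. [cite: Kato2004Asterisque, (15.16.1) (p. 265)] -/
theorem pow_dvd_const_mul_of_le (π v : R) (h7 : (7 : R) = v * π ^ 2) {x : R} {j : ℕ} (hx : π ^ j ∣ x)
    (e k a m₀ m' : ℕ) (w u w' : R) (hle : m₀ + 2 * j ≤ j + (2 * e + 2 * k + a) + m') :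
    π ^ (m₀ + 2 * j) ∣ ((x * (7 : R) ^ e) * (w * ((7 : R) ^ k * (u * π ^ a)))) * (w' * π ^ m') := by
  obtain ⟨c, hc⟩ := hx
  have hpow : π ^ (m₀ + 2 * j) ∣ π ^ (j + (2 * e + 2 * k + a) + m') := pow_dvd_pow π hle
  have hshape : ((x * (7 : R) ^ e) * (w * ((7 : R) ^ k * (u * π ^ a)))) * (w' * π ^ m') =
      π ^ (j + (2 * e + 2 * k + a) + m') * (c * v ^ e * w * v ^ k * u * w') := by
    rw [hc, h7]
    ring
  rw [hshape]
  exact hpow.mul_right _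

/-- **The D916 divisibility input from an integer inequality, 7-adic currency** (general `t`-gauge): with
`j := (α₀² + 7α₁²).valuation`, `cZ := (φ α₀ − φ α₁·π)·7^e·(w·(7^k·(u·π^a)))` and `t′ = w′·π^{m′}`:
`m₀ + 2j ≤ j + (2e + 2k + a) + m′ ⟹ π^(m₀ + 2j) ∣ cZ·t′`. [cite: Kato2004Asterisque, (15.16.1) (p. 265)] -/
theorem pow_dvd_constZ_mul_of_le (φ : ℤ_[7] →+* R) (π v : R) (h7 : (7 : R) = v * π ^ 2) (α₀ α₁ : ℤ_[7])
    (hα : α₀ ≠ 0 ∨ α₁ ≠ 0) (e k a m₀ m' : ℕ) (w u w' : R)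
    (hle : m₀ + 2 * (α₀ ^ 2 + 7 * α₁ ^ 2).valuation ≤
      (α₀ ^ 2 + 7 * α₁ ^ 2).valuation + (2 * e + 2 * k + a) + m') :
    π ^ (m₀ + 2 * (α₀ ^ 2 + 7 * α₁ ^ 2).valuation) ∣
      (((φ α₀ - φ α₁ * π) * (7 : R) ^ e) * (w * ((7 : R) ^ k * (u * π ^ a)))) * (w' * π ^ m') :=
  pow_dvd_const_mul_of_le π v h7
    (pow_dvd_map_sub_map_mul φ π v h7 _ α₀ α₁ (pow_valuation_dvd (normSeven_ne_zero hα))) e k a m₀ m' w u w' hle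

end Kernel

/-- **Injectivity of the reading `ℚ₇ ⊕ ℚ₇·s → ℂ`**: for a ring map `ι : ℚ₇ → ℂ` and `s ∈ ℂ` with `s² = −7`,
`ι a + ι b·s = 0 ↔ a = 0 ∧ b = 0` (`s ∈ ι(ℚ₇)` would make `−7` a square in `ℚ₇`). [cite: Kato2004Asterisque, Prop. 15.9 (pp. 258–259)] -/
theorem padicReading_eq_zero_iff (ι : ℚ_[7] →+* ℂ) (s : ℂ) (hs : s ^ 2 = -7) (a b : ℚ_[7]) :
    ι a + ι b * s = 0 ↔ a = 0 ∧ b = 0 := by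
  constructor
  · intro h
    by_cases hb : b = 0
    · subst hb
      have ha : ι a = 0 := by simpa using h
      exact ⟨(map_eq_zero_iff ι ι.injective).mp ha, rfl⟩
    · exfalso
      have hιb : ι b ≠ 0 := (map_ne_zero_iff ι ι.injective).mpr hb
      have hs' : s = ι (-a / b) := by
        rw [map_div₀, map_neg]
        field_simp
        linear_combination h
      have h7 : ι ((-a / b) ^ 2) = ι (-7) := by
        rw [map_pow, ← hs', hs, map_neg, map_ofNat]
      exact RamifiedSevenEllipticUnits.not_sq_eq_neg_seven_padic (-a / b) (ι.injective h7)
  · rintro ⟨rfl, rfl⟩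
    simp

/-- **The 7-adic reading of a non-zero pair is non-zero**: `(α₀, α₁) ≠ 0` in `ℤ₇` ⟹ `ι α₀ + ι α₁·s ≠ 0` for `s² = −7`.
[cite: Kato2004Asterisque, Prop. 15.9 (pp. 258–259)] -/
theorem padicReading_ne_zero (ι : ℚ_[7] →+* ℂ) (s : ℂ) (hs : s ^ 2 = -7) {α₀ α₁ : ℤ_[7]} (h : α₀ ≠ 0 ∨ α₁ ≠ 0) :
    ι (α₀ : ℚ_[7]) + ι (α₁ : ℚ_[7]) * s ≠ 0 := by
  intro h0
  obtain ⟨h1, h2⟩ := (padicReading_eq_zero_iff ι s hs _ _).mp h0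
  rw [PadicInt.coe_eq_zero] at h1 h2
  rcases h with h | h
  · exact h h1
  · exact h h2

end Padic

end Summit.BirchSwinnertonDyer.Rank1Residual.Additive.GenusSeven

end
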